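import Summits.NavierStokesRegularity.NavierStokesRegularity.Theorems.TautLoopLaw.Negative.ClassicalClauseLoadBearing

/-!
# Crux `TautLoopLaw` (stmt-NavierStokesRegularity-15249), line `Sketch-ideas-r1k1`:
# the right-lsc transfer stub needs its sup-norm right-continuity hypothesis

Negative-side (cdisprove) lemma on the registered pure stub `stub_tautLoopRightLscTransfer` of the picked
line (`Cruxes/TautLoopLaw/Lines/Sketch_ideas_r1k1.lean`): "continuity of the slices + SUP-NORM
RIGHT-CONTINUITY of `s ↦ u s` at `t` + level-left-continuity at `t` ⇒ `ℓ(u t, g) ≤ liminf_{s↓t} ℓ(u s, g)`".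
The stub is true on paper (a near-optimal loop at time `s` is admissible at time `t` at level `g − κ·len`;
`k`-fold covers handle the empty class). Recorded here: the sup-norm clause — i.e. clause (ii) of
`stub_tautLoopSlabRegularity` — is load-bearing:

* `rightLscTransfer_false_without_supnorm` — with the clause
  `(∀ κ > 0, ∀ᶠ s in 𝓝[>] t, ∀ x, ‖u s x − u t x‖ ≤ κ)` DELETED the transfer is FALSE: the family
  `u s = 0` for `s ≤ 0`, `u s = rot` (the rigid rotation) for `s > 0` has continuous slices, an EMPTY
  level-`1` class at `t = 0` (so the level-left-continuity premise holds vacuously and `ℓ(u 0, 1) = ⊤`),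
  while for every `s > 0` the unit circle carries `∮ rot·dl = 2π ≥ 1`, so
  `liminf_{s↓0} ℓ(u s, 1) ≤ ofReal (len unitCircle) < ⊤`.

Uses the landed `Negative/ClassicalClauseLoadBearing.lean` (`rot`, `unitCircle`, `ell`, frame lemmas).
Nothing here closes the item (`--supports`); no Theses statement is concluded positively.
-/

noncomputable section

open MeasureTheory Set Function Filter Real
open scoped Topology RealInnerProductSpace ENNReal
open Literature.Analysis.FluidPDE

namespace Summit.NavierStokesRegularity.NavierStokesRegularity.Theorems.TautLoopLaw.Negative

/-- Local notation for physical space `ℝ³ = EuclideanSpace ℝ (Fin 3)`. -/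
local notation "ℝ³" => EuclideanSpace ℝ (Fin 3)

/-- **The rigid rotation carries circulation `2π` on the unit circle** (its restriction to the circle is
the unit tangent; same computation as for the spike slice, which agrees with `rot` on the sphere). -/
theorem circulation_rot_unitCircle : circulation rot unitCircle = 2 * π := by
  rw [← circulation_spikeVel_at 0]
  unfold circulation
  refine intervalIntegral.integral_congr fun σ _ => ?_
  have hn : ‖unitCircle σ‖ = 1 := by
    rw [unitCircle, circleLoop_apply, one_mul, one_mul, zero_add]
    exact norm_frame_cos_sin _
  simp only [spikeVel_at_of_norm hn]

/-- The switched-on rotation: rest for `s ≤ 0`, the rigid rotation for `s > 0`. -/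
def switchOn : ℝ → ℝ³ → ℝ³ := fun s x => if s ≤ 0 then 0 else rot x

/-- Before (and at) time `0` the switched-on rotation rests. -/
theorem switchOn_of_nonpos {s : ℝ} (hs : s ≤ 0) : switchOn s = 0 := by
  funext x; simp [switchOn, hs]

/-- After time `0` the switched-on rotation is the rigid rotation. -/
theorem switchOn_of_pos {s : ℝ} (hs : 0 < s) : switchOn s = rot := by
  funext x; simp [switchOn, not_le.2 hs]

/-- After time `0` the slices of the switched-on rotation are continuous (the rigid rotation is). -/
theorem continuous_switchOn_of_pos {s : ℝ} (hs : 0 < s) : Continuous (switchOn s) := by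
  rw [switchOn_of_pos hs]
  unfold rot
  fun_prop

/-- `stub_tautLoopRightLscTransfer` with its sup-norm right-continuity clause
`(∀ κ : ℝ, 0 < κ → ∀ᶠ s in nhdsWithin t (Set.Ioi t), ∀ x, ‖u s x - u t x‖ ≤ κ) →` DELETED; everything
else verbatim. -/
def RightLscTransferWithoutSupNorm : Prop :=
  ∀ (u : ℝ → EuclideanSpace ℝ (Fin 3) → EuclideanSpace ℝ (Fin 3)) (t g : ℝ), 0 < g → Continuous (u t) → (∀ᶠ s in nhdsWithin t (Set.Ioi t), Continuous (u s)) → ((∃ γ : ℝ → EuclideanSpace ℝ (Fin 3), Literature.Analysis.FluidPDE.IsC1Loop γ ∧ g ≤ |Literature.Analysis.FluidPDE.circulation (u t) γ|) → (⨅ (γ' : ℝ → EuclideanSpace ℝ (Fin 3)) (_ : Literature.Analysis.FluidPDE.IsC1Loop γ' ∧ g ≤ |Literature.Analysis.FluidPDE.circulation (u t) γ'|), ENNReal.ofReal (∫ σ in (0:ℝ)..1, ‖deriv γ' σ‖)) ≤ ⨆ (g' : ℝ) (_ : 0 < g' ∧ g' < g), (⨅ (γ' : ℝ → EuclideanSpace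 ℝ (Fin 3)) (_ : Literature.Analysis.FluidPDE.IsC1Loop γ' ∧ g' ≤ |Literature.Analysis.FluidPDE.circulation (u t) γ'|), ENNReal.ofReal (∫ σ in (0:ℝ)..1, ‖deriv γ' σ‖))) → (⨅ (γ' : ℝ → EuclideanSpace ℝ (Fin 3)) (_ : Literature.Analysis.FluidPDE.IsC1Loop γ' ∧ g ≤ |Literature.Analysis.FluidPDE.circulation (u t) γ'|), ENNReal.ofReal (∫ σ in (0:ℝ)..1, ‖deriv γ' σ‖)) ≤ Filter.liminf (fun s => (⨅ (γ' : ℝ → EuclideanSpace ℝ (Fin 3)) (_ : Literature.Analysis.FluidPDE.IsC1Loop γ' ∧ g ≤ |Literature.Analysis.FluidPDE.circulation (u s) γ'|), ENNReal.ofReal (∫ σ in (0:ℝ)..1, ‖deriv γ' σ‖))) (nhdsWithin t (Set.Ioi t))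

/-- **The sup-norm right-continuity clause of the transfer stub is load-bearing.** Witness: the
switched-on rotation at `t = 0`, level `g = 1`: `ℓ(u 0, 1) = ⊤` (rest slice, empty class — the
level-left-continuity premise is vacuous) but `ℓ(u s, 1) ≤ ofReal (len unitCircle) < ⊤` for all
`s > 0` (the unit circle carries `2π ≥ 1`), so the `liminf` is finite and `⊤ ≤ liminf` fails. For the
line: clause (ii) of `stub_tautLoopSlabRegularity` (sup-norm right-continuity of the classical slices,
including at `t = 0`) cannot be dropped. -/
theorem rightLscTransfer_false_without_supnorm : ¬ RightLscTransferWithoutSupNorm := by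
  intro h
  have h0 : switchOn 0 = 0 := switchOn_of_nonpos le_rfl
  have hcont : Continuous (switchOn 0) := by rw [h0]; exact continuous_const
  have hnear : ∀ᶠ s in 𝓝[>] (0 : ℝ), Continuous (switchOn s) := by
    filter_upwards [self_mem_nhdsWithin] with s hs
    exact continuous_switchOn_of_pos hs
  have hvac : (∃ γ : ℝ → ℝ³, IsC1Loop γ ∧ (1 : ℝ) ≤ |circulation (switchOn 0) γ|) →
      ell (switchOn 0) 1 ≤ ⨆ (g' : ℝ) (_ : 0 < g' ∧ g' < 1), ell (switchOn 0) g' := by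
    rintro ⟨γ, -, hγ⟩
    rw [h0, circulation_zero_left, abs_zero] at hγ
    exact absurd hγ (by norm_num)
  have key := h switchOn 0 1 one_pos hcont hnear hvac
  change ell (switchOn 0) 1 ≤ liminf (fun s => ell (switchOn s) 1) (𝓝[>] (0 : ℝ)) at key
  rw [h0, ell_zero one_pos, top_le_iff] at key
  -- the liminf is finite: eventually the slice is `rot`, whose spectrum at level 1 is finite
  have hadm : IsC1Loop unitCircle ∧ (1 : ℝ) ≤ |circulation rot unitCircle| := by
    refine ⟨isC1Loop_unitCircle, ?_⟩
    rw [circulation_rot_unitCircle, abs_of_pos (by positivity)]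
    linarith [pi_gt_three]
  have hfin : ell rot 1 < ⊤ := by
    unfold ell
    exact (iInf₂_le unitCircle hadm).trans_lt ENNReal.ofReal_lt_top
  have hev : ∀ᶠ s in 𝓝[>] (0 : ℝ), ell (switchOn s) 1 = (fun _ : ℝ => ell rot 1) s := by
    filter_upwards [self_mem_nhdsWithin] with s hs
    rw [switchOn_of_pos hs]
  have hlim : liminf (fun s => ell (switchOn s) 1) (𝓝[>] (0 : ℝ)) = ell rot 1 := by
    rw [liminf_congr hev, liminf_const]
  rw [hlim] at key
  exact absurd key hfin.ne

end Summit.NavierStokesRegularity.NavierStokesRegularity.Theorems.TautLoopLaw.Negative
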